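import Literature.AlgebraicGeometry.HodgeTheory.HarmonicFiltrationKernel
import Literature.AlgebraicGeometry.HodgeTheory.PeriodIntegralVariation
import Literature.Analysis.Complex.PQTypesWedgeVanishing
import Literature.Geometry.Kaehler.ComplexTorusHodgeRiemann
import HarnessLib

/-!
# The Hodge filtration is the annihilator of `F^{d-p+1}` under the wedge pairing
# (Voisin I §7.1.2: `F^pH^k = (F^{d-p+1}H^{2d-k})^⊥`), harmonic form

Topic: Hodge theory of compact Kähler manifolds (Voisin (2002), §6.1.3, §7.1.2). Theorems only, no
definition, no named fact. Written by the prover seat `hodge-nonav-prover-Bx` (g17, cell `hodge-nonav`)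
as brick **K4** of the programme «GRIFFITHS-HOLOMORPHY» (memo
`PROGRAMME-GRIFFITHS-HOLOMORPHY-Bx-g17.md`): the test-functional clause of
`Literature.Analysis.Complex.exists_analyticOnNhd_frame_of_ker_of_differentiableAt` — "the common kernel
of the functionals `c ↦ ∫_M c ∧ β_j` is contained in `F^p`".

Let `(M, g, o)` be a compact Kähler manifold of complex dimension `d` (`dim_ℝ E = n = 2d`), `k + m = n`.
Voisin (2002), §7.1.2: under the Poincaré pairing `(α, β) ↦ ∫_M α ∧ β` one has
`F^pH^k(M) = (F^{d-p+1}H^m(M))^⊥` — "for reasons of type" `F^p ∧ F^{d-p+1} = 0` in top degree, and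
the pairing is perfect on `H^{r,s} × H^{d-r,d-s}`. This file proves the inclusion `⊇` that the
programme needs, in the following form (`mem_hodgeFiltration_of_forall_cintegral_wedge_eq_zero`):
**if a closed `k`-form `η` integrates to zero against every closed `m`-form `β` all of whose
`(a,b)`-components with `a + p ≤ d` vanish (`β ∈ F^{d-p+1}A^m`), then `[η] ∈ F^pH^k = ⨆_{r ≥ p} K^{r,k-r}`**
— GRANTED the non-degeneracy of the wedge pairing on de Rham cohomology (hypothesis `hPD`: every
non-zero class of degree `k` pairs non-trivially with some closed `m`-form; for the analytification of
a smooth projective variety this is the tree's Poincaré duality `BettiUniverse.separatingLeft_tr_cup`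
read through `BettiUniverse.exists_trC_eq_mul_cintegral`, supplied by the consumer).

Proof (Voisin §6.1.3 + §7.1.2): let `η₀` be the `Δ_d`-harmonic representative of `[η]`; its type
components `η₀^{r,s}` are harmonic (Kähler identity `Δ_d = 2Δ_∂̄`), hence closed. If `[η] ∉ F^p`, some
`θ = η₀^{r,s}` with `r < p` is non-zero (`mem_hodgeFiltration_iff_typeComponent_eq_zero`), and `[θ] ≠ 0`
(uniqueness of harmonic representatives). By `hPD` there is a closed `γ` with `∫ θ ∧ γ ≠ 0`; replacing
`γ` by its harmonic representative `γ₀ = Σ γ₀^{a,b}` does not change the integral (Stokes), and only the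
component `β := γ₀^{d-r,d-s}` survives the type count (`(r+a, s+b) = (d,d)` is forced in top degree).
This `β` is closed, of pure type `(d-r,d-s)` with `d - r ≥ d - p + 1`, hence an admissible test form,
and `∫ η ∧ β = ∫ η₀ ∧ β = ∫ θ ∧ β = ∫ θ ∧ γ ≠ 0` — contradiction.

Also recorded: the pointwise type count `wedge_typeProjAt_typeProjAt_eq_zero_of_ne` and the two
Stokes vanishings `cintegral_wedge_eq_zero_of_mem_cexactSmoothForms_left/right`.

## References

* C. Voisin, *Hodge Theory and Complex Algebraic Geometry I*, CUP (2002), §6.1.3 Prop. 6.11, §7.1.2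
  (p. 160: `F^kH^{2k-1} = F^{n-k+1}H^{2n-2k+1}^⊥`), §10.2.2. [VoisinHodgeI2002] [Voisin2002]
* F. W. Warner, *Foundations of Differentiable Manifolds and Lie Groups*, GTM 94 (1983), Thm. 4.9
  (Stokes), 2.20 (Leibniz). [WarnerGTM94]
-/

noncomputable section

open scoped Manifold ContDiff Topology
open Bundle Module Set Finset

namespace Literature.AlgebraicGeometry.HodgeTheory

open Literature.Geometry.Kaehler Literature.NumberTheory.Transcendental
  Literature.AlgebraicGeometry.Motives Literature.Analysis.Complex

-- `TangentSpace 𝓘(ℝ, E) x = E` silently, as in the tree's form files.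
set_option backward.isDefEq.respectTransparency false

/-! ### Pointwise type count in top degree -/

section Pointwise

variable {E : Type*} [NormedAddCommGroup E] [NormedSpace ℂ E] [FiniteDimensional ℂ E]

/-- **Type count in top degree**: for a `k`-form `u` and an `l`-form `v` on a complex vector space of
dimension `d` with `k + l = 2d`, the wedge of the `(r,s)`-component of `u` and the
`(a,b)`-component of `v` vanishes unless `r + a = d` (the product has type `(r+a, s+b)` with
`r + a + s + b = 2d`, so one index exceeds `d`; the second-index case by conjugation, cf. the
tree's `IsOfTypeAt.eq_zero_of_finrank_lt_snd'`). Voisin (2002), §7.1.2 ("for reasons of type").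
[cite: VoisinHodgeI2002, §7.1.2] -/
theorem wedge_typeProjAt_typeProjAt_eq_zero_of_ne {k l r s a b : ℕ} (hkl : k + l = 2 * finrank ℂ E)
    (hrs : r + s = k) (hab : a + b = l) (hne : r + a ≠ finrank ℂ E)
    (u : E [⋀^Fin k]→L[ℝ] ℂ) (v : E [⋀^Fin l]→L[ℝ] ℂ) :
    (typeProjAt r s u).wedge (typeProjAt a b v) = 0 := by
  have hT := (isOfTypeAt_typeProjAt hrs u).wedge (isOfTypeAt_typeProjAt hab v)
  rcases Nat.lt_or_gt_of_ne hne with hlt | hgt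
  · -- the second type index exceeds the dimension: conjugate and use the first-index vanishing
    have h' := (Literature.Geometry.Kaehler.ComplexTorus.isOfTypeAt_conjForm hT).eq_zero_of_finrank_lt_fst
      (by omega)
    rwa [Literature.LinearAlgebra.Alternating.conj_eq_zero_iff] at h'
  · exact hT.eq_zero_of_finrank_lt_fst hgt

end Pointwise

/-! ### Forms on a manifold: type components pointwise, Stokes for the wedge pairing -/

section Manifold

variable {E : Type*} [NormedAddCommGroup E] [NormedSpace ℂ E] [FiniteDimensional ℂ E]
  [MeasurableSpace E] [BorelSpace E]
  {M : Type*} [TopologicalSpace M] [ChartedSpace E M] [IsManifold 𝓘(ℝ, E) ∞ M]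
  [IsManifold 𝓘(ℂ, E) ω M] [T2Space M] [CompactSpace M] {n : ℕ} [Fact (finrank ℝ E = n)]
  (o : (x : M) → Orientation ℝ (TangentSpace 𝓘(ℝ, E) x) (Fin n))

omit [FiniteDimensional ℂ E] [MeasurableSpace E] [BorelSpace E] [IsManifold 𝓘(ℝ, E) ∞ M]
  [IsManifold 𝓘(ℂ, E) ω M] [T2Space M] [CompactSpace M] [Fact (finrank ℝ E = n)] in
/-- The `(p,q)`-component of a form is computed pointwise: `(α^{p,q}) x = (α x)^{p,q}`
(`typeProjAt`; definitional, as for flat forms `typeComponent_apply`; Voisin (2002), §2.3.1 eq. (2.4)).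
[cite: VoisinHodgeI2002, §2.3.1] -/
theorem typeComponent_apply' (p q : ℕ) {k : ℕ} (α : MForm 𝓘(ℝ, E) M ℂ k) (x : M) :
    (α.typeComponent p q) x = typeProjAt p q (show E [⋀^Fin k]→L[ℝ] ℂ from α x) := by
  unfold typeProjAt MForm.typeComponent MForm.weightComponent
  split_ifs <;> rfl

omit [FiniteDimensional ℂ E] [MeasurableSpace E] [BorelSpace E] [IsManifold 𝓘(ℝ, E) ∞ M]
  [IsManifold 𝓘(ℂ, E) ω M] [T2Space M] [CompactSpace M] [Fact (finrank ℝ E = n)] in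
/-- Exactness is insensitive to the degree cast (bookkeeping for Warner's `d`). [cite: WarnerGTM94, 2.20] -/
theorem castDeg_mem_cexactSmoothForms {a b : ℕ} (e : a = b) {α : MForm 𝓘(ℝ, E) M ℂ a}
    (hα : α ∈ cexactSmoothForms E M a) : α.castDeg e ∈ cexactSmoothForms E M b := by
  subst e
  simpa [MForm.castDeg_rfl] using hα

omit [IsManifold 𝓘(ℂ, E) ω M] in
/-- **Stokes, exact factor on the left**: `∫_M α ∧ β = 0` for `α` exact smooth and `β` closed smooth
of complementary degree (`dψ ∧ β = d(ψ ∧ β)` for closed `β`). [cite: WarnerGTM94, Thm. 4.9 and 2.20] -/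
theorem cintegral_wedge_eq_zero_of_mem_cexactSmoothForms_left (hoc : IsContinuousOrientation o)
    {k l : ℕ} (h : k + l = n) {α : MForm 𝓘(ℝ, E) M ℂ k} (hα : α ∈ cexactSmoothForms E M k)
    {β : MForm 𝓘(ℝ, E) M ℂ l} (hβ : IsSmoothForm β) (hβc : IsClosedForm β) :
    cintegral o ((α.wedge β).castDeg h) = 0 := by
  haveI : WedgeFacts 𝓘(ℝ, E) M ℂ := wedgeFacts_discharged _ _ ℂ
  cases k with
  | zero =>
    have h0 : α = 0 := by simpa [cexactSmoothForms] using hα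
    subst h0
    rw [MForm.zero_wedge, MForm.castDeg_zero]
    exact HodgeRiemannDegreeOne.cintegral_eq_zero_of_mem_cexactSmoothForms o hoc (Submodule.zero_mem _)
  | succ k =>
    obtain ⟨ψ, hψ, rfl⟩ := (mem_cexactSmoothForms_succ_iff α).1 hα
    -- `dψ ∧ β = d(ψ ∧ β)` up to the degree cast
    have hL := mextDeriv_wedge (I := 𝓘(ℝ, E)) (M := M) (A := ℂ) hψ hβ
    rw [show mextDeriv β = 0 from hβc, MForm.wedge_zero, smul_zero, add_zero] at hL
    have hex : ((mextDeriv ψ).wedge β).castDeg (Nat.add_right_comm k 1 l) ∈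
        cexactSmoothForms E M (k + l + 1) := by
      rw [← hL]
      exact Submodule.subset_span ⟨ψ.wedge β, mem_csmoothForms (isSmoothForm_wedge hψ hβ), rfl⟩
    have hex' : ((mextDeriv ψ).wedge β).castDeg h ∈ cexactSmoothForms E M n := by
      have := castDeg_mem_cexactSmoothForms (show k + l + 1 = n by omega) hex
      subst h
      simpa [MForm.castDeg_castDeg, MForm.castDeg_rfl] using this
    exact HodgeRiemannDegreeOne.cintegral_eq_zero_of_mem_cexactSmoothForms o hoc hex'

omit [IsManifold 𝓘(ℂ, E) ω M] in
/-- **Stokes, exact factor on the right**: `∫_M α ∧ β = 0` for `α` closed smooth and `β` exact smooth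
of complementary degree (`α ∧ dψ = ± d(α ∧ ψ)`, the tree's `wedge_mextDeriv_mem_cexactSmoothForms`).
[cite: WarnerGTM94, Thm. 4.9 and 2.20] -/
theorem cintegral_wedge_eq_zero_of_mem_cexactSmoothForms_right (hoc : IsContinuousOrientation o)
    {k l : ℕ} (h : k + l = n) {α : MForm 𝓘(ℝ, E) M ℂ k} (hα : IsSmoothForm α) (hαc : IsClosedForm α)
    {β : MForm 𝓘(ℝ, E) M ℂ l} (hβ : β ∈ cexactSmoothForms E M l) :
    cintegral o ((α.wedge β).castDeg h) = 0 := by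
  haveI : WedgeFacts 𝓘(ℝ, E) M ℂ := wedgeFacts_discharged _ _ ℂ
  cases l with
  | zero =>
    have h0 : β = 0 := by simpa [cexactSmoothForms] using hβ
    subst h0
    rw [MForm.wedge_zero, MForm.castDeg_zero]
    exact HodgeRiemannDegreeOne.cintegral_eq_zero_of_mem_cexactSmoothForms o hoc (Submodule.zero_mem _)
  | succ l =>
    obtain ⟨ψ, hψ, rfl⟩ := (mem_cexactSmoothForms_succ_iff β).1 hβ
    have hex := wedge_mextDeriv_mem_cexactSmoothForms hα hαc hψ
    have hex' : (α.wedge (mextDeriv ψ)).castDeg h ∈ cexactSmoothForms E M n :=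
      castDeg_mem_cexactSmoothForms h hex
    exact HodgeRiemannDegreeOne.cintegral_eq_zero_of_mem_cexactSmoothForms o hoc hex'

/-! ### Wedge against a pure-type form kills all but one component -/

omit [MeasurableSpace E] [BorelSpace E] [IsManifold 𝓘(ℝ, E) ∞ M] [IsManifold 𝓘(ℂ, E) ω M] [T2Space M]
  [CompactSpace M] [Fact (finrank ℝ E = n)] in
/-- **Only the complementary component pairs**: for a `k`-form `α` and an `m`-form `γ` on a complex
manifold of dimension `d`, `k + m = 2d`, and types `(r,s)`, `(a,b)` with `r + a = d`:
`α ∧ γ^{a,b} = α^{r,s} ∧ γ^{a,b}` and `α^{r,s} ∧ γ = α^{r,s} ∧ γ^{a,b}` (all other components have the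
wrong type to reach `(d,d)`, `wedge_typeProjAt_typeProjAt_eq_zero_of_ne`). Voisin (2002), §7.1.2.
[cite: VoisinHodgeI2002, §7.1.2] -/
theorem wedge_typeComponent_eq_typeComponent_wedge_typeComponent {k m r s a b : ℕ}
    (hkm : k + m = 2 * finrank ℂ E) (hrs : r + s = k) (hab : a + b = m) (hra : r + a = finrank ℂ E)
    (α : MForm 𝓘(ℝ, E) M ℂ k) (γ : MForm 𝓘(ℝ, E) M ℂ m) :
    α.wedge (γ.typeComponent a b) = (α.typeComponent r s).wedge (γ.typeComponent a b) ∧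
      (α.typeComponent r s).wedge γ = (α.typeComponent r s).wedge (γ.typeComponent a b) := by
  classical
  constructor
  · conv_lhs => rw [← sum_antidiagonal_typeComponent_holds α]
    rw [MForm.sum_wedge]
    refine Finset.sum_eq_single (r, s) (fun pq hpq hne ↦ ?_)
      (fun h ↦ (h (mem_antidiagonal.2 hrs)).elim)
    funext x
    rw [MForm.wedge_apply, typeComponent_apply', typeComponent_apply']
    refine wedge_typeProjAt_typeProjAt_eq_zero_of_ne hkm (mem_antidiagonal.1 hpq) hab ?_ _ _
    intro h'
    apply hne
    have h1 : pq.1 = r := by omega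
    have h2 : pq.2 = s := by have := mem_antidiagonal.1 hpq; omega
    exact Prod.ext h1 h2
  · conv_lhs => rw [← sum_antidiagonal_typeComponent_holds γ]
    rw [MForm.wedge_sum]
    refine Finset.sum_eq_single (a, b) (fun pq hpq hne ↦ ?_)
      (fun h ↦ (h (mem_antidiagonal.2 hab)).elim)
    funext x
    rw [MForm.wedge_apply, typeComponent_apply', typeComponent_apply']
    refine wedge_typeProjAt_typeProjAt_eq_zero_of_ne hkm hrs (mem_antidiagonal.1 hpq) ?_ _ _
    intro h'
    apply hne
    have h1 : pq.1 = a := by omega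
    have h2 : pq.2 = b := by have := mem_antidiagonal.1 hpq; omega
    exact Prod.ext h1 h2

/-! ### The main theorem -/

variable (g : ContMDiffRiemannianMetric 𝓘(ℝ, E) ∞ E (fun x : M ↦ TangentSpace 𝓘(ℝ, E) x))

/-- **`(F^{d-p+1}A^m_{closed})^⊥ ⊆ F^pH^k` — the Hodge filtration is cut out by the wedge pairing with
closed forms of complementary filtration level** (Voisin (2002), §7.1.2: `F^pH^k = F^{d-p+1}H^{2d-k}^⊥`,
the perfectness of `H^{r,s} × H^{d-r,d-s} → ℂ`; §6.1.3 Prop. 6.11 for the harmonic bookkeeping).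
Compact Kähler `(M, g, o)` of complex dimension `d`, `k + m = dim_ℝ M`, `vol_o` smooth and `o`
continuous; HYPOTHESIS `hPD`: the wedge pairing `([θ], [γ]) ↦ ∫_M θ ∧ γ` on de Rham cohomology is
left non-degenerate (Poincaré duality; for analytifications of smooth projective varieties the tree's
`BettiUniverse.separatingLeft_tr_cup` + `exists_trC_eq_mul_cintegral`). CONCLUSION: a closed `k`-form
`η` with `∫_M η ∧ β = 0` for every closed `m`-form `β` whose `(a,b)`-components with `a + p ≤ d` all
vanish has its class in `F^pH^k = ⨆_{r ≥ p} K^{r,k-r}`. (Proof in the module docstring.) This is the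
clause `(∀ v, (∀ j, ℓ j v = 0) → v ∈ P t)` of
`Literature.Analysis.Complex.exists_analyticOnNhd_frame_of_ker_of_differentiableAt` for the Hodge
bundles. [cite: VoisinHodgeI2002, §7.1.2 and §6.1.3 Prop. 6.11] -/
theorem mem_hodgeFiltration_of_forall_cintegral_wedge_eq_zero (hg : g.toRiemannianMetric.IsKaehler)
    {k m : ℕ} (h : k + m = n) (p : ℕ) (hoc : IsContinuousOrientation o) :
    letI : RiemannianBundle (fun x : M ↦ TangentSpace 𝓘(ℝ, E) x) := ⟨g.toRiemannianMetric⟩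
    IsSmoothForm (riemannianVolumeForm o) →
      (∀ θ : cclosedSmoothForms E M k, complexDeRhamCohomology.mk E M k θ ≠ 0 →
        ∃ γ : cclosedSmoothForms E M m,
          cintegral o (((θ : MForm 𝓘(ℝ, E) M ℂ k).wedge (γ : MForm 𝓘(ℝ, E) M ℂ m)).castDeg h) ≠ 0) →
      ∀ η : cclosedSmoothForms E M k,
        (∀ β : cclosedSmoothForms E M m,
          (∀ (x : M) (a b : ℕ), a + p ≤ finrank ℂ E →
            typeProjAt a b (show E [⋀^Fin m]→L[ℝ] ℂ from (β : MForm 𝓘(ℝ, E) M ℂ m) x) = 0) →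
          cintegral o (((η : MForm 𝓘(ℝ, E) M ℂ k).wedge (β : MForm 𝓘(ℝ, E) M ℂ m)).castDeg h) = 0) →
        complexDeRhamCohomology.mk E M k η ∈
          ⨆ pq ∈ {pq ∈ antidiagonal k | p ≤ pq.1}, hodgePQ E M k pq.1 pq.2 := by
  letI : RiemannianBundle (fun x : M ↦ TangentSpace 𝓘(ℝ, E) x) := ⟨g.toRiemannianMetric⟩
  haveI : IsContMDiffRiemannianBundle 𝓘(ℝ, E) ∞ E (fun x : M ↦ TangentSpace 𝓘(ℝ, E) x) :=
    ⟨g.inner, g.contMDiff, fun _ _ _ ↦ rfl⟩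
  intro ho hPD η hη
  classical
  haveI : WedgeFacts 𝓘(ℝ, E) M ℂ := wedgeFacts_discharged _ _ ℂ
  have h' : m + k = n := by omega
  have hK := cHodgeLaplacian_eq_two_smul_dolbeaultLaplacian_of_isManifold_complex_of_t2Space
    (k := k) (m := m) g o
  have hK' := cHodgeLaplacian_eq_two_smul_dolbeaultLaplacian_of_isManifold_complex_of_t2Space
    (k := m) (m := k) g o
  have h11 := existsUnique_isHarmonicForm_mk_eq_of_compact_of_isKaehler g o hg k m
  have h11' := existsUnique_isHarmonicForm_mk_eq_of_compact_of_isKaehler g o hg m k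
  -- the complex dimension `d`, `n = 2d`
  set d := finrank ℂ E with hd
  have hnd : n = 2 * d := by
    rw [← (Fact.out : finrank ℝ E = n)]
    exact finrank_real_of_complex E
  -- Cor. 6.9/6.10: type components of harmonic forms are harmonic, hence closed
  have hT : ∀ (a b : ℕ) {α : MForm 𝓘(ℝ, E) M ℂ k},
      IsCHarmonicForm o h α → IsCHarmonicForm o h (α.typeComponent a b) := fun a b α hα ↦
    (mem_charmonicForms_iff_of_contMDiffMetric o ho h _).1
      (typeComponent_mem_charmonicForms_of_kaehlerIdentity g o hK hg h a b ho (hα.mem_charmonicForms o))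
  have hT' : ∀ (a b : ℕ) {α : MForm 𝓘(ℝ, E) M ℂ m},
      IsCHarmonicForm o h' α → IsCHarmonicForm o h' (α.typeComponent a b) := fun a b α hα ↦
    (mem_charmonicForms_iff_of_contMDiffMetric o ho h' _).1
      (typeComponent_mem_charmonicForms_of_kaehlerIdentity g o hK' hg h' a b ho (hα.mem_charmonicForms o))
  -- the harmonic representative `η₀` of `[η]`
  obtain ⟨η₀, hη₀, hη₀c⟩ := exists_isCHarmonicForm_mk_eq o h11 ho h (complexDeRhamCohomology.mk E M k η)
  rw [← hη₀c]
  refine (mem_hodgeFiltration_iff_typeComponent_eq_zero g o hg h p ho η₀ hη₀).2 fun r s hr ↦ ?_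
  by_contra hθne
  -- off the antidiagonal there is nothing to prove
  by_cases hrs : r + s = k
  swap
  · exact hθne (MForm.typeComponent_of_ne hrs _)
  -- `θ := η₀^{r,s}`, harmonic, closed, with non-zero class
  set θ : MForm 𝓘(ℝ, E) M ℂ k := (η₀ : MForm 𝓘(ℝ, E) M ℂ k).typeComponent r s with hθdef
  have hθh : IsCHarmonicForm o h θ := hT r s hη₀
  have hθcl : θ ∈ cclosedSmoothForms E M k :=
    (mem_cclosedSmoothForms_iff _).2 ⟨hθh.1, mextDeriv_eq_zero_of_isCHarmonicForm o ho h hθh⟩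
  have hθc : complexDeRhamCohomology.mk E M k ⟨θ, hθcl⟩ ≠ 0 := by
    intro h0
    have heq := eq_of_isCHarmonicForm_of_mk_eq o ho h (α := ⟨θ, hθcl⟩) (β := 0) hθh
      (by simpa using isCHarmonicForm_zero o h) (by rw [h0, map_zero])
    exact hθne (by simpa using congrArg Subtype.val heq)
  -- `r, s ≤ d` (a non-zero form of type `(r,s)`)
  have hr_le : r ≤ d := by
    by_contra hlt
    push Not at hlt
    apply hθne
    funext x
    rw [hθdef, typeComponent_apply']
    exact (isOfTypeAt_typeProjAt hrs _).eq_zero_of_finrank_lt_fst hlt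
  have hs_le : s ≤ d := by
    by_contra hlt
    push Not at hlt
    apply hθne
    funext x
    rw [hθdef, typeComponent_apply']
    have h' := (Literature.Geometry.Kaehler.ComplexTorus.isOfTypeAt_conjForm
      (isOfTypeAt_typeProjAt hrs (show E [⋀^Fin k]→L[ℝ] ℂ from (η₀ : MForm 𝓘(ℝ, E) M ℂ k) x))).eq_zero_of_finrank_lt_fst hlt
    rwa [Literature.LinearAlgebra.Alternating.conj_eq_zero_iff] at h'
  obtain ⟨a, hra⟩ : ∃ a, r + a = d := ⟨d - r, by omega⟩
  obtain ⟨b, hsb⟩ : ∃ b, s + b = d := ⟨d - s, by omega⟩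
  have hab : a + b = m := by omega
  have hkm : k + m = 2 * finrank ℂ E := by rw [← hd]; omega
  -- a Poincaré partner `γ` of `θ`, and its harmonic representative `γ₀`
  obtain ⟨γ, hγ⟩ := hPD ⟨θ, hθcl⟩ hθc
  obtain ⟨γ₀, hγ₀, hγ₀c⟩ :=
    exists_isCHarmonicForm_mk_eq o h11' ho h' (complexDeRhamCohomology.mk E M m γ)
  -- the test form `β := γ₀^{a,b}`
  set β : MForm 𝓘(ℝ, E) M ℂ m := (γ₀ : MForm 𝓘(ℝ, E) M ℂ m).typeComponent a b with hβdef
  have hβh : IsCHarmonicForm o h' β := hT' a b hγ₀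
  have hβcl : β ∈ cclosedSmoothForms E M m :=
    (mem_cclosedSmoothForms_iff _).2 ⟨hβh.1, mextDeriv_eq_zero_of_isCHarmonicForm o ho h' hβh⟩
  have hβF : ∀ (x : M) (a' b' : ℕ), a' + p ≤ finrank ℂ E →
      typeProjAt a' b' (show E [⋀^Fin m]→L[ℝ] ℂ from β x) = 0 := by
    intro x a' b' ha'
    have hx : (show E [⋀^Fin m]→L[ℝ] ℂ from β x) =
        typeProjAt a b (show E [⋀^Fin m]→L[ℝ] ℂ from (γ₀ : MForm 𝓘(ℝ, E) M ℂ m) x) := by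
      rw [hβdef, typeComponent_apply']
    rw [hx]
    refine (isOfTypeAt_typeProjAt hab _).typeProjAt_of_ne (Or.inl ?_)
    intro haa'
    rw [← hd] at ha'
    omega
  -- smoothness bookkeeping
  have hηs : IsSmoothForm (η : MForm 𝓘(ℝ, E) M ℂ k) := ((mem_cclosedSmoothForms_iff _).1 η.2).1
  have hηc' : IsClosedForm (η : MForm 𝓘(ℝ, E) M ℂ k) := ((mem_cclosedSmoothForms_iff _).1 η.2).2
  have hη₀s : IsSmoothForm (η₀ : MForm 𝓘(ℝ, E) M ℂ k) := hη₀.1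
  have hγs : IsSmoothForm (γ : MForm 𝓘(ℝ, E) M ℂ m) := ((mem_cclosedSmoothForms_iff _).1 γ.2).1
  have hγc' : IsClosedForm (γ : MForm 𝓘(ℝ, E) M ℂ m) := ((mem_cclosedSmoothForms_iff _).1 γ.2).2
  have hγ₀s : IsSmoothForm (γ₀ : MForm 𝓘(ℝ, E) M ℂ m) := hγ₀.1
  have hθs : IsSmoothForm θ := hθh.1
  have hθcl' : IsClosedForm θ := mextDeriv_eq_zero_of_isCHarmonicForm o ho h hθh
  have hβs : IsSmoothForm β := hβh.1
  have hβcl' : IsClosedForm β := mextDeriv_eq_zero_of_isCHarmonicForm o ho h' hβh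
  -- (1) `∫ η ∧ β = 0` by hypothesis
  have h1 : cintegral o (((η : MForm 𝓘(ℝ, E) M ℂ k).wedge β).castDeg h) = 0 := hη ⟨β, hβcl⟩ hβF
  -- (2) `∫ η ∧ β = ∫ η₀ ∧ β` (`η - η₀` exact, `β` closed)
  have hex1 : (η : MForm 𝓘(ℝ, E) M ℂ k) - η₀ ∈ cexactSmoothForms E M k :=
    (complexDeRhamCohomology.mk_eq_mk_iff η η₀).1 hη₀c.symm
  have h2 : cintegral o (((η : MForm 𝓘(ℝ, E) M ℂ k).wedge β).castDeg h) =
      cintegral o (((η₀ : MForm 𝓘(ℝ, E) M ℂ k).wedge β).castDeg h) := by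
    have hsplit : ((η : MForm 𝓘(ℝ, E) M ℂ k).wedge β).castDeg h =
        (((η : MForm 𝓘(ℝ, E) M ℂ k) - η₀).wedge β).castDeg h +
          ((η₀ : MForm 𝓘(ℝ, E) M ℂ k).wedge β).castDeg h := by
      rw [← MForm.castDeg_add, MForm.sub_wedge, sub_add_cancel]
    rw [hsplit, HodgeRiemannDegreeOne.cintegral_add' o hoc
      (isSmoothForm_castDeg h (isSmoothForm_wedge (hηs.sub hη₀s) hβs))
      (isSmoothForm_castDeg h (isSmoothForm_wedge hη₀s hβs)),
      cintegral_wedge_eq_zero_of_mem_cexactSmoothForms_left o hoc h hex1 hβs hβcl', zero_add]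
  -- (3) `η₀ ∧ β = θ ∧ β` and `θ ∧ γ₀ = θ ∧ β` as forms (type count)
  obtain ⟨h3, h5⟩ := wedge_typeComponent_eq_typeComponent_wedge_typeComponent (M := M) hkm hrs hab hra
    (η₀ : MForm 𝓘(ℝ, E) M ℂ k) (γ₀ : MForm 𝓘(ℝ, E) M ℂ m)
  -- (4) `∫ θ ∧ γ = ∫ θ ∧ γ₀` (`γ - γ₀` exact, `θ` closed)
  have hex2 : (γ : MForm 𝓘(ℝ, E) M ℂ m) - γ₀ ∈ cexactSmoothForms E M m :=
    (complexDeRhamCohomology.mk_eq_mk_iff γ γ₀).1 hγ₀c.symm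
  have h4 : cintegral o ((θ.wedge (γ : MForm 𝓘(ℝ, E) M ℂ m)).castDeg h) =
      cintegral o ((θ.wedge (γ₀ : MForm 𝓘(ℝ, E) M ℂ m)).castDeg h) := by
    have hsplit : (θ.wedge (γ : MForm 𝓘(ℝ, E) M ℂ m)).castDeg h =
        (θ.wedge ((γ : MForm 𝓘(ℝ, E) M ℂ m) - (γ₀ : MForm 𝓘(ℝ, E) M ℂ m))).castDeg h +
          (θ.wedge (γ₀ : MForm 𝓘(ℝ, E) M ℂ m)).castDeg h := by
      rw [← MForm.castDeg_add, MForm.wedge_sub, sub_add_cancel]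
    rw [hsplit, HodgeRiemannDegreeOne.cintegral_add' o hoc
      (isSmoothForm_castDeg h (isSmoothForm_wedge hθs (hγs.sub hγ₀s)))
      (isSmoothForm_castDeg h (isSmoothForm_wedge hθs hγ₀s)),
      cintegral_wedge_eq_zero_of_mem_cexactSmoothForms_right o hoc h hθs hθcl' hex2, zero_add]
  -- conclusion: `∫ θ ∧ γ = ∫ θ ∧ β = ∫ η₀ ∧ β = ∫ η ∧ β = 0`
  apply hγ
  change cintegral o ((θ.wedge (γ : MForm 𝓘(ℝ, E) M ℂ m)).castDeg h) = 0
  rw [h4, h5, ← h3, ← h2, h1]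

end Manifold

end Literature.AlgebraicGeometry.HodgeTheory

end
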